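import Mathlib
import Summits.MatrixMultiplication.MatrixMultiplication.Theorems.SnSubsetDichotomyHyperoctahedralSubsetsSurgeryTransfer
import Summits.MatrixMultiplication.MatrixMultiplication.Theorems.SnSubsetDichotomyHyperoctahedralSubsetsSubhostTransport
import Summits.MatrixMultiplication.MatrixMultiplication.Theorems.SnSubsetDichotomyHyperoctahedralSubsetsRematch

/-!
# `SnSubsetDichotomy.HyperoctahedralSubsets`, line `spherical-rank-sieve` — the SURGERY STEP of the bulk recursion

Helper for crux `stmt-MatrixMultiplication-8305` (lead c1; memo `Cruxes/HyperoctahedralSubsets/LeadC1-PoorCore.md`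
§5).  Write `f(μ)` for the largest number of support-disjoint commuting local triples of a host `μ` (three
fixed-point-free involutions of `Fin n`); the matching lemma (open core of the line) is `f ≥ c√n`.  The bulk
attack is a recursion over pieces: cut a vertex set `P` of even size out of the 3-edge-coloured cubic graph,
re-match the scars on both sides, apply the statement to the two smaller hosts, transport the local triples
back and discard those touching a scar.  This file composes the three landed plumbing lemmas
`stub_rematch` (p103260), `stub_subhostTransport` (p102569) and `stub_surgeryTransfer` (p100062) into the
resulting RECURSION INEQUALITY

  `f(μ) ≥ f(sub-host on P) + f(sub-host on Pᶜ) − #scars`,   `#scars = #{v : ∃ c, ¬(v ∈ P ↔ μ c v ∈ P)}`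

stated in hypothesis form (`stub_surgeryStep`): if EVERY host on `|P|` points has `G₁` support-disjoint
local triples and every host on `|Pᶜ|` points has `G₂`, then `μ` has `g` of them with
`G₁ + G₂ ≤ g + #scars`.  With `√s + √(n−s) − √n ≥ √s/2` for `s ≤ n/2` this makes "no cut around `s`
vertices with fewer than `(c/4)√s` cut edges" a free normalisation of the open core (each cut edge has at
most two scars). [this line]
-/

-- the project's summit namespace `Summit.MatrixMultiplication.MatrixMultiplication` repeats a component by design (D-0022)
set_option linter.dupNamespace false

namespace Summit.MatrixMultiplication.MatrixMultiplication.Theorems.HyperoctahedralSubsets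

open Equiv Equiv.Perm Finset

/-- **Surgery step** (crux `SnSubsetDichotomy.HyperoctahedralSubsets`, stmt-MatrixMultiplication-8305, line
`spherical-rank-sieve`).  Let `μ 0, μ 1, μ 2` be fixed-point-free involutions of `Fin n` and `P` a vertex set of
even size; let the sub-hosts be formed along the canonical enumerations `P.equivFin.symm`, `Pᶜ.equivFin.symm`
of the RE-MATCHED host (`stub_rematch`).  If every triple of fixed-point-free involutions of `Fin |P|` admits
`G₁` support-disjoint commuting local triples and every such triple on `Fin |Pᶜ|` admits `G₂`, then `μ` admits
`g` support-disjoint commuting local triples with `G₁ + G₂ ≤ g + #scars`, where the scars are the vertices `v`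
with `¬(v ∈ P ↔ μ c v ∈ P)` for some colour `c` (endpoints of cut edges).  Proof: re-match (`stub_rematch`),
restrict to `P` and `Pᶜ`, apply the hypotheses, transport back (`stub_subhostTransport`; supports lie in `P`
resp. `Pᶜ`, so the union is support-disjoint), drop the members whose support meets a scar (at most one member
per scar by disjointness), and transfer the rest to `μ` (`stub_surgeryTransfer`). [this line] -/
theorem stub_surgeryStep :
    ∀ (n : ℕ) (μ : Fin 3 → Equiv.Perm (Fin n)), (∀ c, μ c * μ c = 1 ∧ ∀ v, μ c v ≠ v) →
      ∀ (P : Finset (Fin n)), Even P.card → ∀ (G₁ G₂ : ℕ),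
        (∀ ν : Fin 3 → Equiv.Perm (Fin P.card), (∀ c, ν c * ν c = 1 ∧ ∀ x, ν c x ≠ x) →
          ∃ (a b : Fin G₁ → Equiv.Perm (Fin P.card)),
            (∀ j, a j * a j = 1 ∧ b j * b j = 1 ∧ a j * b j = b j * a j ∧ (a j ≠ 1 ∨ b j ≠ 1) ∧
              a j * ν 0 = ν 0 * a j ∧ b j * ν 1 = ν 1 * b j ∧ a j * b j * ν 2 = ν 2 * (a j * b j)) ∧
            (∀ j j' : Fin G₁, j ≠ j' → ∀ x, (a j x ≠ x ∨ b j x ≠ x) → a j' x = x ∧ b j' x = x)) →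
        (∀ ν : Fin 3 → Equiv.Perm (Fin Pᶜ.card), (∀ c, ν c * ν c = 1 ∧ ∀ x, ν c x ≠ x) →
          ∃ (a b : Fin G₂ → Equiv.Perm (Fin Pᶜ.card)),
            (∀ j, a j * a j = 1 ∧ b j * b j = 1 ∧ a j * b j = b j * a j ∧ (a j ≠ 1 ∨ b j ≠ 1) ∧
              a j * ν 0 = ν 0 * a j ∧ b j * ν 1 = ν 1 * b j ∧ a j * b j * ν 2 = ν 2 * (a j * b j)) ∧
            (∀ j j' : Fin G₂, j ≠ j' → ∀ x, (a j x ≠ x ∨ b j x ≠ x) → a j' x = x ∧ b j' x = x)) →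
        ∃ (g : ℕ) (a b : Fin g → Equiv.Perm (Fin n)),
          G₁ + G₂ ≤ g + (univ.filter fun v : Fin n => ∃ c, ¬ (v ∈ P ↔ μ c v ∈ P)).card ∧
          (∀ j, a j * a j = 1 ∧ b j * b j = 1 ∧ a j * b j = b j * a j ∧ (a j ≠ 1 ∨ b j ≠ 1) ∧
            a j * μ 0 = μ 0 * a j ∧ b j * μ 1 = μ 1 * b j ∧ a j * b j * μ 2 = μ 2 * (a j * b j)) ∧
          (∀ j j' : Fin g, j ≠ j' → ∀ v, (a j v ≠ v ∨ b j v ≠ v) → a j' v = v ∧ b j' v = v) := by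
  intro n μ hμ P hP G₁ G₂ ih₁ ih₂
  classical
  -- re-match
  obtain ⟨μ', hμ', hPinv, hagree⟩ := stub_rematch n μ hμ P hP
  set Z : Finset (Fin n) := univ.filter fun v : Fin n => ∃ c, ¬ (v ∈ P ↔ μ c v ∈ P) with hZ
  have hagreeZ : ∀ c, ∀ v ∉ Z, μ' c v = μ c v := by
    intro c v hv
    apply hagree c v
    by_contra h
    exact hv (mem_filter.2 ⟨mem_univ _, c, h⟩)
  -- the two sub-hosts
  have hS₁ : ∀ c, ∀ v, μ' c v ∈ P ↔ v ∈ P := hPinv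
  have hS₂ : ∀ c, ∀ v, μ' c v ∈ Pᶜ ↔ v ∈ Pᶜ := fun c v => by
    rw [mem_compl, mem_compl, hPinv]
  set e₁ : Fin P.card ≃ {v // v ∈ P} := P.equivFin.symm with he₁
  set e₂ : Fin Pᶜ.card ≃ {v // v ∈ Pᶜ} := (Pᶜ).equivFin.symm with he₂
  set ν₁ : Fin 3 → Perm (Fin P.card) := fun c => e₁.symm.permCongr ((μ' c).subtypePerm (hS₁ c))
    with hν₁
  set ν₂ : Fin 3 → Perm (Fin Pᶜ.card) := fun c => e₂.symm.permCongr ((μ' c).subtypePerm (hS₂ c))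
    with hν₂
  -- they are fixed-point-free involutions
  have apply_sub : ∀ {S : Finset (Fin n)} (σ : Perm (Fin n)) (hσ : ∀ v, σ v ∈ S ↔ v ∈ S)
      (e : Fin S.card ≃ {v // v ∈ S}) (x : Fin S.card),
      ((e (e.symm.permCongr (σ.subtypePerm hσ) x) : {v // v ∈ S}) : Fin n) = σ (e x) := by
    intro S σ hσ e x
    simp [Equiv.permCongr_apply, subtypePerm_apply]
  have fpfinv : ∀ {S : Finset (Fin n)} (σ : Perm (Fin n)) (hσ : ∀ v, σ v ∈ S ↔ v ∈ S)
      (e : Fin S.card ≃ {v // v ∈ S}), σ * σ = 1 → (∀ v, σ v ≠ v) →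
      e.symm.permCongr (σ.subtypePerm hσ) * e.symm.permCongr (σ.subtypePerm hσ) = 1 ∧
        ∀ x, e.symm.permCongr (σ.subtypePerm hσ) x ≠ x := by
    intro S σ hσ e h1 h2
    constructor
    · rw [← Equiv.permCongr_mul]
      have : σ.subtypePerm hσ * σ.subtypePerm hσ = 1 := by
        ext x
        simp [h1]
      rw [this]
      ext x
      simp
    · intro x hx
      have := congrArg (fun y => ((e y : {v // v ∈ S}) : Fin n)) hx
      rw [apply_sub σ hσ e x] at this
      exact h2 _ this
  have hν₁ok : ∀ c, ν₁ c * ν₁ c = 1 ∧ ∀ x, ν₁ c x ≠ x := fun c =>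
    fpfinv (μ' c) (hS₁ c) e₁ (hμ' c).1 (hμ' c).2
  have hν₂ok : ∀ c, ν₂ c * ν₂ c = 1 ∧ ∀ x, ν₂ c x ≠ x := fun c =>
    fpfinv (μ' c) (hS₂ c) e₂ (hμ' c).1 (hμ' c).2
  -- induction hypotheses on the two sides, transported back
  obtain ⟨a₁', b₁', h₁', d₁'⟩ := ih₁ ν₁ hν₁ok
  obtain ⟨a₂', b₂', h₂', d₂'⟩ := ih₂ ν₂ hν₂ok
  obtain ⟨a₁, b₁, h₁, d₁, s₁⟩ := stub_subhostTransport n P.card μ' P hS₁ e₁ G₁ a₁' b₁' h₁' d₁'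
  obtain ⟨a₂, b₂, h₂, d₂, s₂⟩ := stub_subhostTransport n Pᶜ.card μ' Pᶜ hS₂ e₂ G₂ a₂' b₂' h₂' d₂'
  -- the combined family, indexed by `Fin (G₁ + G₂)`
  set A : Fin (G₁ + G₂) → Perm (Fin n) := Fin.append a₁ a₂ with hA
  set B : Fin (G₁ + G₂) → Perm (Fin n) := Fin.append b₁ b₂ with hB
  have hAB : ∀ j, (A j * A j = 1 ∧ B j * B j = 1 ∧ A j * B j = B j * A j ∧ (A j ≠ 1 ∨ B j ≠ 1) ∧
      A j * μ' 0 = μ' 0 * A j ∧ B j * μ' 1 = μ' 1 * B j ∧ A j * B j * μ' 2 = μ' 2 * (A j * B j)) := by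
    intro j
    refine Fin.addCases (fun i => ?_) (fun i => ?_) j
    · simpa [hA, hB] using h₁ i
    · simpa [hA, hB] using h₂ i
  have hsuppA : ∀ j v, (A j v ≠ v ∨ B j v ≠ v) →
      (∃ i : Fin G₁, j = Fin.castAdd G₂ i ∧ v ∈ P) ∨ (∃ i : Fin G₂, j = Fin.natAdd G₁ i ∧ v ∈ Pᶜ) := by
    intro j
    refine Fin.addCases (fun i => ?_) (fun i => ?_) j
    · intro v hv
      left
      refine ⟨i, rfl, s₁ i v ?_⟩
      simpa [hA, hB] using hv
    · intro v hv
      right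
      refine ⟨i, rfl, s₂ i v ?_⟩
      simpa [hA, hB] using hv
  have hdisjAB : ∀ j j', j ≠ j' → ∀ v, (A j v ≠ v ∨ B j v ≠ v) → A j' v = v ∧ B j' v = v := by
    intro j j' hjj' v hv
    rcases hsuppA j v hv with ⟨i, rfl, hvP⟩ | ⟨i, rfl, hvP⟩
    · refine Fin.addCases (fun i' => ?_) (fun i' => ?_) j' hjj'
      · intro hne
        have hv1 : a₁ i v ≠ v ∨ b₁ i v ≠ v := by simpa [hA, hB] using hv
        have hii' : i ≠ i' := fun h => hne (by rw [h])
        simpa [hA, hB] using d₁ i i' hii' v hv1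
      · intro _
        -- supports of the second family lie in `Pᶜ`
        have hn : ¬ (a₂ i' v ≠ v ∨ b₂ i' v ≠ v) := fun h => by
          have := s₂ i' v h
          rw [mem_compl] at this
          exact this hvP
        obtain ⟨k1, k2⟩ := not_or.1 hn
        have e1 : A (Fin.natAdd G₁ i') = a₂ i' := by simp [hA]
        have e2 : B (Fin.natAdd G₁ i') = b₂ i' := by simp [hB]
        rw [e1, e2]
        exact ⟨not_not.1 k1, not_not.1 k2⟩
    · refine Fin.addCases (fun i' => ?_) (fun i' => ?_) j' hjj'
      · intro _
        have hn : ¬ (a₁ i' v ≠ v ∨ b₁ i' v ≠ v) := fun h => by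
          have := s₁ i' v h
          rw [mem_compl] at hvP
          exact hvP this
        obtain ⟨k1, k2⟩ := not_or.1 hn
        have e1 : A (Fin.castAdd G₂ i') = a₁ i' := by simp [hA]
        have e2 : B (Fin.castAdd G₂ i') = b₁ i' := by simp [hB]
        rw [e1, e2]
        exact ⟨not_not.1 k1, not_not.1 k2⟩
      · intro hne
        have hv1 : a₂ i v ≠ v ∨ b₂ i v ≠ v := by simpa [hA, hB] using hv
        have hii' : i ≠ i' := fun h => hne (by rw [h])
        simpa [hA, hB] using d₂ i i' hii' v hv1
  -- discard the members touching the scars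
  set K : Finset (Fin (G₁ + G₂)) := univ.filter fun j => ∀ v, (A j v ≠ v ∨ B j v ≠ v) → v ∉ Z
    with hK
  have hKc : G₁ + G₂ ≤ K.card + Z.card := by
    set Bad : Finset (Fin (G₁ + G₂)) :=
      univ.filter fun j : Fin (G₁ + G₂) => ¬ ∀ v, (A j v ≠ v ∨ B j v ≠ v) → v ∉ Z with hBad
    -- the bad indices inject into `Z`
    have hch : ∀ j ∈ Bad, ∃ z ∈ Z, (A j z ≠ z ∨ B j z ≠ z) := by
      intro j hj
      rw [mem_filter] at hj
      obtain ⟨v, hv⟩ := not_forall.1 hj.2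
      obtain ⟨hv1, hv2⟩ := Classical.not_imp.1 hv
      exact ⟨v, not_not.1 hv2, hv1⟩
    have hbad : Bad.card ≤ Z.card := by
      rcases Bad.eq_empty_or_nonempty with hE | ⟨j₀, hj₀⟩
      · rw [hE, card_empty]; exact Nat.zero_le _
      · obtain ⟨z₀, -, -⟩ := hch j₀ hj₀
        haveI : Nonempty (Fin n) := ⟨z₀⟩
        choose! f hfZ hfmv using hch
        refine card_le_card_of_injOn f (fun j hj => hfZ j hj) ?_
        intro j hj j' hj' hff
        by_contra hne
        have h1 := hfmv j hj
        have h2 := hfmv j' hj'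
        rw [← hff] at h2
        have := hdisjAB j' j (fun h => hne h.symm) (f j) h2
        rcases h1 with h1 | h1
        · exact h1 this.1
        · exact h1 this.2
    have hsum : K.card + Bad.card = G₁ + G₂ := by
      have h := Finset.card_filter_add_card_filter_not (s := (univ : Finset (Fin (G₁ + G₂))))
        (fun j => ∀ v, (A j v ≠ v ∨ B j v ≠ v) → v ∉ Z)
      rw [card_univ, Fintype.card_fin] at h
      rw [hK, hBad]
      exact h
    omega
  -- re-index the good members by `Fin K.card`
  set eK := K.equivFin with heK
  refine ⟨K.card, fun i => A (eK.symm i).1, fun i => B (eK.symm i).1, hKc, ?_, ?_⟩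
  · intro i
    have hmem : (eK.symm i).1 ∈ K := (eK.symm i).2
    rw [mem_filter] at hmem
    have hμinv : ∀ c, μ c * μ c = 1 := fun c => (hμ c).1
    have hμ'inv : ∀ c, μ' c * μ' c = 1 := fun c => (hμ' c).1
    have := stub_surgeryTransfer n μ μ' Z hμinv hμ'inv hagreeZ 1 (fun _ => A (eK.symm i).1) (fun _ => B (eK.symm i).1)
      (fun _ => hAB _) (fun _ v hv => hmem.2 v hv) 0
    exact this
  · intro i i' hii' v hv
    have hne : (eK.symm i).1 ≠ (eK.symm i').1 := fun h =>
      hii' (eK.symm.injective (Subtype.ext h))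
    exact hdisjAB _ _ hne v hv

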